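import Literature.NumberTheory.Sieve.MatomakiRadziwillProp1CoefU1
import Literature.NumberTheory.Sieve.MatomakiRadziwillProp1CoefU2
import HarnessLib

/-!
# Matomäki–Radziwiłł 2016, Proposition 1 for general coefficients — (d3) the bound for `∫_𝒰` (§8.3)

Topic `NumberTheory/Sieve`.  Everything in this file is PROVED; no definitions, no named facts.

General-coefficient form of the `𝒰`-part of §8.3 of K. Matomäki, M. Radziwiłł, *Multiplicative functions in short
intervals*, Ann. of Math. 183 (2016) (`MatomakiRadziwillProp1U3.lean`: `TS_sum_le`, `sum_block_le`,
`sum_blocks_integral_le`, `integral_Uset_bound`), as needed for complex `f` in Matomäki–Radziwiłł–Tao 2015,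
Appendix A (proof of Proposition A.3, range `𝒯₂`):

* the coefficients are arbitrary `1`-bounded complex sequences `a` (for `F` and the cofactor polynomials
  `R_{v,H}`) and `c` (for the prime polynomials `Q_{v,H}`), with the factorisation `a_{mp} = a_m c_p` for primes
  `p ∈ [e^{L^{97/100}}, e^{L^{99/100}}]`, `p ∤ m` (`L = log X`) as a hypothesis (`hfac`);
* the interval system is attached to `X₀` with `e² ≤ X₀ ≤ X`, `log X ≤ 2 log X₀` (`MatomakiRadziwillProp1CoefU2.lean`);
* the integration set is `𝒰 ⊆ [T₀, T]` for any `0 ≤ T₀` (the tree file has `T₀ = (log X)^{1/15}`), still with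
  `X^{1/4} ≤ T ≤ X`;
* **the Halász input is a hypothesis**: instead of Lemma 3 for all real multiplicative functions (the `h3` of the tree
  file, used only through `norm_blockCofactorPoly_le`), the pointwise bound
  `|R_{v,H}(1+it)| ≤ 2^J · 3 C₃ L^{1/50-1/16}` for `t ∈ [T₀, T]` and every block `v` is assumed (`hR`).  For real `f` it
  is `norm_blockCofactorPoly_le`; for complex `f` it is Lemma A.4 of Matomäki–Radziwiłł–Tao with Lemma 5, valid on
  `[T₀, T] ⊆ 𝒯₂` only — which is why `T₀` is kept general.

The proofs are those of the tree file verbatim up to these substitutions; the conclusion of `integral_Uset_bound_coef`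
is literally that of `integral_Uset_bound`.

## References
* K. Matomäki, M. Radziwiłł, Ann. of Math. (2) 183 (2016), 1015–1056 (arXiv:1501.04585), §8.3 (arXiv p. 17).
  [cite: MatomakiRadziwillAnnals2016, §8.3]
* K. Matomäki, M. Radziwiłł, T. Tao, Algebra & Number Theory 9 (2015), Appendix A, Proposition A.3 (proof), Lemma A.4.
  [cite: MatomakiRadziwillTao2015, Appendix A, Proposition A.3 (proof)]
-/

noncomputable section

open Finset Complex MeasureTheory

namespace Literature.NumberTheory.Sieve

namespace SieveIntervalSystem

variable {η X₀ : ℝ} (I : SieveIntervalSystem η X₀)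

/-! ### The small values `𝒯_S`, general coefficients -/

set_option maxHeartbeats 400000 in
/-- **The small values** (§8.3: "By Lemma 9, `∑_{t ∈ 𝒯_S} |Q_{v,H} R_{v,H}|² ≪ (log X)^{-200} (X e^{-v/H} + |𝒯| T^{1/2})
log(2T) (X e^{-v/H})⁻¹ ≪ (log X)^{-199}`"), explicitly: under `c2, c3` and the `η`-dependent size condition
`c4 : L^{1/14} √L exp((2/3)√L + L^{99/100} - 2ηL) ≤ 1` (`L = log X`), for `X^{1/4} ≤ T ≤ X`, `H₁ ≥ 2`, a `1`-spaced
`𝒯 ⊂ [T₀, T]` with `#𝒯 ≤ #ℐ_J C₈ e^{(√L)/2} X^{1/2-2η}` (`card_witness_le`) and a block index `v`: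
`∑_{t ∈ 𝒯, |Q_{v,H}| < L^{-100}} |Q_{v,H} R_{v,H}|² ≤ 2 C₉ (4 + 4^20 C₈) L · L^{-200}`.
[cite: MatomakiRadziwillAnnals2016, §8.3] -/
theorem TS_sum_le_coef {C₈ C₉ : ℝ} (hC₈ : 0 ≤ C₈) (hC₉ : 0 ≤ C₉) (h9 : (∀ (N : ℕ) (a : ℕ → ℂ) (T : ℝ) (𝒯 : Finset ℝ), 1 ≤ N → 1 ≤ T →
      (∀ t ∈ 𝒯, |t| ≤ T) → (∀ t ∈ 𝒯, ∀ t' ∈ 𝒯, t ≠ t' → 1 ≤ |t - t'|) →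
      ∑ t ∈ 𝒯, ‖∑ n ∈ Finset.Icc 1 N, a n * (n : ℂ) ^ (-((t : ℂ) * Complex.I))‖ ^ 2 ≤
        C₉ * (N + (Finset.card 𝒯 : ℕ) * Real.sqrt T) * Real.log (2 * T) * ∑ n ∈ Finset.Icc 1 N, ‖a n‖ ^ 2)) (hη : 0 < η) (hη6 : η < 1 / 6)
    {a : ℕ → ℂ} (ha : ∀ m, ‖a m‖ ≤ 1) (c : ℕ → ℂ) {X : ℝ} (hXe : Real.exp 1 ≤ X)
    (hX₀e : Real.exp 1 ≤ X₀) (hX₀X : X₀ ≤ X)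
    (c2 : 2 ≤ Real.log X ^ (1 / 50 : ℝ)) (c3 : 40 * Real.log X ^ (99 / 100 : ℝ) ≤ Real.log X)
    (c4 : Real.log X ^ (1 / 14 : ℝ) * Real.sqrt (Real.log X) *
      Real.exp (2 / 3 * Real.sqrt (Real.log X) + Real.log X ^ (99 / 100 : ℝ) - 2 * η * Real.log X) ≤ 1)
    {T₀ T : ℝ} (hT₀ : 0 ≤ T₀) (hXT : X ^ (1 / 4 : ℝ) ≤ T) (hTX : T ≤ X) (hH1 : 2 ≤ I.Hpar 1) {v : ℕ}
    (hv : v ∈ Icc ⌊Real.log X ^ (1 / 50 : ℝ) * Real.log (Real.exp (Real.log X ^ (97 / 100 : ℝ)))⌋₊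
      ⌊Real.log X ^ (1 / 50 : ℝ) * Real.log (Real.exp (Real.log X ^ (99 / 100 : ℝ)))⌋₊)
    (𝒯 : Finset ℝ) (h𝒯 : ∀ t ∈ 𝒯, t ∈ Set.Icc T₀ T) (hws : ∀ t ∈ 𝒯, ∀ t' ∈ 𝒯, t ≠ t' → 1 ≤ |t - t'|)
    (hcard : (#𝒯 : ℝ) ≤ #(I.blocks I.J) * (C₈ * Real.exp (Real.sqrt (Real.log X) / 2) * X ^ (1 / 2 - 2 * η : ℝ))) :
    ∑ t ∈ 𝒯.filter (fun t => ‖blockPrimePoly c (Real.exp (Real.log X ^ (97 / 100 : ℝ)))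
        (Real.exp (Real.log X ^ (99 / 100 : ℝ))) (Real.log X ^ (1 / 50 : ℝ)) v t‖ < (Real.log X ^ 100)⁻¹),
      ‖blockPrimePoly c (Real.exp (Real.log X ^ (97 / 100 : ℝ))) (Real.exp (Real.log X ^ (99 / 100 : ℝ)))
          (Real.log X ^ (1 / 50 : ℝ)) v t *
        blockCofactorPoly a X (Real.exp (Real.log X ^ (97 / 100 : ℝ)))
          (Real.exp (Real.log X ^ (99 / 100 : ℝ))) (Real.log X ^ (1 / 50 : ℝ)) v t‖ ^ 2 ≤
      2 * C₉ * (4 + 4 ^ 20 * C₈) * Real.log X * ((Real.log X ^ 100) ^ 2)⁻¹ := by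
  classical
  have hη' : η ≤ 8 := by linarith
  set L := Real.log X with hLdef
  set H := L ^ (1 / 50 : ℝ) with hHdef
  have hX0 : 0 < X := (Real.exp_pos 1).trans_le hXe
  have hL1 : 1 ≤ L := by rw [hLdef, ← Real.log_exp 1]; exact Real.log_le_log (Real.exp_pos 1) hXe
  have hL0 : 0 < L := by linarith
  obtain ⟨hL400, h40, hL99, hL97, h97, h9799⟩ := MatomakiRadziwillU.Lfacts hL1 c2 c3
  rw [Real.log_exp, Real.log_exp] at hv
  have hH2 : 2 ≤ H := c2
  have hH0 : 0 < H := by linarith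
  obtain ⟨hx1, hx2⟩ := MatomakiRadziwillU.div_mem_of_mem_Icc hH0 (Real.rpow_nonneg hL0.le _) hv
  have hX : X = Real.exp L := by rw [hLdef, Real.exp_log hX0]
  -- `X' = X e^{-x} = e^{L-x} ≥ 1`, `T ≥ 1`
  have hX'eq : X * Real.exp (-((v : ℝ) / H)) = Real.exp (L - v / H) := by rw [hX, ← Real.exp_add]; ring_nf
  have hX'1 : 1 ≤ X * Real.exp (-((v : ℝ) / H)) := by
    rw [hX'eq]
    refine Real.one_le_exp ?_
    have : L ^ (99 / 100 : ℝ) ≤ L / 40 := by linarith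
    linarith
  have hXrpow : ∀ y : ℝ, X ^ y = Real.exp (L * y) := fun y => Real.rpow_def_of_pos hX0 y
  have hT4 : Real.exp (L / 4) ≤ T := by rw [hXrpow] at hXT; convert hXT using 2; ring
  have hT1 : 1 ≤ T := by have := Real.add_one_le_exp (L / 4); linarith
  have hT0 : 0 < T := by linarith
  have habs : ∀ t ∈ 𝒯, |t| ≤ T := fun t ht => by
    have h := h𝒯 t ht
    rw [abs_of_nonneg (hT₀.trans h.1)]; exact h.2
  have hlog2T : Real.log (2 * T) ≤ 2 * L := by
    have h1 : Real.log (2 * T) ≤ Real.log (2 * X) := Real.log_le_log (by linarith) (by linarith)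
    rw [Real.log_mul two_ne_zero hX0.ne'] at h1
    have h2 : Real.log 2 < 1 := by
      rw [← Real.log_exp 1]
      exact Real.log_lt_log two_pos (by linarith [Real.exp_one_gt_d9])
    linarith
  have hlog2T0 : 0 ≤ Real.log (2 * T) := Real.log_nonneg (by linarith)
  have hsqrtT : Real.sqrt T ≤ Real.exp (L / 2) := by
    rw [show Real.exp (L / 2) = Real.sqrt (Real.exp L) by rw [← Real.exp_half]]
    exact Real.sqrt_le_sqrt (by rw [← hX]; exact hTX)
  rw [hXrpow] at hcard
  have hIJ := I.card_blocks_J_le' hη hη6 hX₀e hX₀X (by linarith)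
  -- Lemma 9 for `R_{v,H}` and the `𝒯_S`-step
  have hB : 0 < L ^ 100 := by positivity
  refine (MatomakiRadziwillU.sum_filter_small_le _ _ hB 𝒯).trans ?_
  have hR := MatomakiRadziwillU.sum_norm_sq_cofactor_le hC₉ h9 ha X
    (Real.exp (L ^ (97 / 100 : ℝ))) (Real.exp (L ^ (99 / 100 : ℝ))) H v hX'1 hT1 𝒯 habs hws
  rw [mul_comm]
  refine mul_le_mul_of_nonneg_right (hR.trans ?_) (by positivity)
  exact TS_numeric hC₈ hC₉ hX'eq hx2 hsqrtT (Real.sqrt_nonneg _) (Nat.cast_nonneg _)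
    hcard hIJ c4 hlog2T hlog2T0


/-! ### One block `v`: `𝒯 = 𝒯_S ∪ 𝒯_L`, general coefficients -/

set_option maxHeartbeats 400000 in
/-- **The sum over one well-spaced set** (§8.3, `𝒯 = 𝒯_S ∪ 𝒯_L`): under the size conditions, for `X^{1/4} ≤ T ≤ X`,
`H₁ ≥ 2`, a `1`-spaced `𝒯 ⊂ [(log X)^{1/15}, T]` with the point count of `card_witness_le`, and a block `v`,
`∑_{t ∈ 𝒯} |Q_{v,H} R_{v,H}|²(t) ≤ 2C₉(4 + 4^20 C₈) L·L^{-200} + (2^J 3C₃ L^{1/50-1/16})² · 24 C₁₁ C (1+C₈)/(H (L^{97/100})²)`.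
[cite: MatomakiRadziwillAnnals2016, §8.3] -/
theorem sum_block_le_coef {C₃ C₈ C₉ C₁₁ C : ℝ} (hC₈ : 0 ≤ C₈)
    (h8 : (∀ (P T V : ℝ) (a : ℕ → ℂ) (𝒯 : Finset ℝ), 2 ≤ P → P ^ 2 ≤ T →
      Real.exp (Real.exp 4) ≤ T → 1 ≤ V → (∀ p, ‖a p‖ ≤ 1) → (∀ t ∈ 𝒯, |t| ≤ T) →
      (∀ t ∈ 𝒯, ∀ t' ∈ 𝒯, t ≠ t' → 1 ≤ |t - t'|) →
      (∀ t ∈ 𝒯, V⁻¹ ≤ ‖∑ p ∈ (Finset.Icc ⌈P⌉₊ ⌊2 * P⌋₊).filter Nat.Prime,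
          a p * (p : ℂ) ^ (-(1 + (t : ℂ) * Complex.I))‖) →
      ((Finset.card 𝒯 : ℕ) : ℝ) ≤ C₈ * V ^ 2 * T ^ (2 * Real.log V / Real.log P)
        * Real.exp (4 * (Real.log T / Real.log P) * Real.log (Real.log T)))) (hC₉ : 0 ≤ C₉) (h9 : (∀ (N : ℕ) (a : ℕ → ℂ) (T : ℝ) (𝒯 : Finset ℝ), 1 ≤ N → 1 ≤ T →
      (∀ t ∈ 𝒯, |t| ≤ T) → (∀ t ∈ 𝒯, ∀ t' ∈ 𝒯, t ≠ t' → 1 ≤ |t - t'|) →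
      ∑ t ∈ 𝒯, ‖∑ n ∈ Finset.Icc 1 N, a n * (n : ℂ) ^ (-((t : ℂ) * Complex.I))‖ ^ 2 ≤
        C₉ * (N + (Finset.card 𝒯 : ℕ) * Real.sqrt T) * Real.log (2 * T) * ∑ n ∈ Finset.Icc 1 N, ‖a n‖ ^ 2)) (hC₁₁ : 0 ≤ C₁₁) (h11 : (∀ (P T : ℝ) (a : ℕ → ℂ) (𝒯 : Finset ℝ), 2 ≤ P → 2 ≤ T →
      (∀ t ∈ 𝒯, |t| ≤ T) → (∀ t ∈ 𝒯, ∀ t' ∈ 𝒯, t ≠ t' → 1 ≤ |t - t'|) →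
      ∑ t ∈ 𝒯, ‖∑ p ∈ (Finset.Icc ⌈P⌉₊ ⌊2 * P⌋₊).filter Nat.Prime,
          a p * (p : ℂ) ^ (-((t : ℂ) * Complex.I))‖ ^ 2 ≤
        C₁₁ * (P + ((Finset.card 𝒯 : ℕ) : ℝ) * P * Real.exp (-(Real.log P / Real.log T ^ (2 / 3 + 1 / 10 : ℝ)))
            * Real.log T ^ 2)
          * ∑ p ∈ (Finset.Icc ⌈P⌉₊ ⌊2 * P⌋₊).filter Nat.Prime, ‖a p‖ ^ 2 / Real.log P))
    (hC : 0 ≤ C) (hBT : ∀ N M : ℕ, 2 ≤ M → (#((Ioc N (N + M)).filter Nat.Prime) : ℝ) ≤ C * M / Real.log M)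
    (hη : 0 < η) (hη6 : η < 1 / 6) (a c : ℕ → ℂ) (ha : ∀ m, ‖a m‖ ≤ 1) (hc : ∀ p, ‖c p‖ ≤ 1) {X : ℝ}
    (hXe : Real.exp 1 ≤ X) (hX₀ : Real.exp 2 ≤ X₀) (hX₀X : X₀ ≤ X) (hLX₀ : Real.log X ≤ 2 * Real.log X₀)
    (c2 : 2 ≤ Real.log X ^ (1 / 50 : ℝ)) (c3 : 40 * Real.log X ^ (99 / 100 : ℝ) ≤ Real.log X)
    (c4 : Real.log X ^ (1 / 14 : ℝ) * Real.sqrt (Real.log X) *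
      Real.exp (2 / 3 * Real.sqrt (Real.log X) + Real.log X ^ (99 / 100 : ℝ) - 2 * η * Real.log X) ≤ 1)
    (c6 : Real.log X ^ 202 * Real.exp (408 * Real.log X ^ (3 / 100 : ℝ) * Real.log (Real.log X)
      - Real.log X ^ (61 / 300 : ℝ) / 2) ≤ 1)
    (c7 : 4 * Real.log X ≤ Real.exp (Real.log X ^ (97 / 100 : ℝ) / 2))
    {T₀ T : ℝ} (hT₀ : 0 ≤ T₀) (hXT : X ^ (1 / 4 : ℝ) ≤ T) (hTX : T ≤ X) (hH1 : 2 ≤ I.Hpar 1) {v : ℕ}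
    (hv : v ∈ (Icc ⌊Real.log X ^ (1 / 50 : ℝ) * Real.log (Real.exp (Real.log X ^ (97 / 100 : ℝ)))⌋₊
      ⌊Real.log X ^ (1 / 50 : ℝ) * Real.log (Real.exp (Real.log X ^ (99 / 100 : ℝ)))⌋₊))
    (𝒯 : Finset ℝ)
    (hRv : ∀ t ∈ 𝒯, ‖blockCofactorPoly a X (Real.exp (Real.log X ^ (97 / 100 : ℝ)))
        (Real.exp (Real.log X ^ (99 / 100 : ℝ))) (Real.log X ^ (1 / 50 : ℝ)) v t‖ ≤
      2 ^ I.J * (3 * C₃ * Real.log X ^ (1 / 50 - 1 / 16 : ℝ)))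
    (h𝒯 : ∀ t ∈ 𝒯, t ∈ Set.Icc T₀ T ∧ ∃ v ∈ I.blocks I.J,
      Real.exp (-(alpha η I.J * v / I.Hpar I.J)) ≤
        ‖blockPrimePoly c (I.P I.J) (I.Q I.J) (I.Hpar I.J) v t‖)
    (hws : ∀ t ∈ 𝒯, ∀ t' ∈ 𝒯, t ≠ t' → 1 ≤ |t - t'|) :
    ∑ t ∈ 𝒯, ‖(blockPrimePoly c (Real.exp (Real.log X ^ (97 / 100 : ℝ))) (Real.exp (Real.log X ^ (99 / 100 : ℝ)))
          (Real.log X ^ (1 / 50 : ℝ)) v t) *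
        blockCofactorPoly a X (Real.exp (Real.log X ^ (97 / 100 : ℝ)))
          (Real.exp (Real.log X ^ (99 / 100 : ℝ))) (Real.log X ^ (1 / 50 : ℝ)) v t‖ ^ 2 ≤
      2 * C₉ * (4 + 4 ^ 20 * C₈) * Real.log X * ((Real.log X ^ 100) ^ 2)⁻¹ +
        (2 ^ I.J * (3 * C₃ * Real.log X ^ (1 / 50 - 1 / 16 : ℝ))) ^ 2 *
          (24 * C₁₁ * C * (1 + C₈) / (Real.log X ^ (1 / 50 : ℝ) * (Real.log X ^ (97 / 100 : ℝ)) ^ 2)) := by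
  classical
  have hL1 : 1 ≤ Real.log X := by rw [← Real.log_exp 1]; exact Real.log_le_log (Real.exp_pos 1) hXe
  have hL400 := (MatomakiRadziwillU.Lfacts hL1 c2 c3).1
  have hX₀e : Real.exp 1 ≤ X₀ := (Real.exp_le_exp.2 (by norm_num)).trans hX₀
  have h𝒯' : ∀ t ∈ 𝒯, t ∈ Set.Icc T₀ T := fun t ht => (h𝒯 t ht).1
  have hcard := I.card_witness_le' hC₈ h8 hη hη6 hc hXe hX₀ hX₀X hLX₀ hL400 hT₀ hXT hTX hH1 𝒯 h𝒯 hws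
  rw [← sum_filter_add_sum_filter_not 𝒯 (fun t => ‖(blockPrimePoly c (Real.exp (Real.log X ^ (97 / 100 : ℝ))) (Real.exp (Real.log X ^ (99 / 100 : ℝ)))
          (Real.log X ^ (1 / 50 : ℝ)) v t)‖ < (Real.log X ^ 100)⁻¹)]
  refine add_le_add ?_ ?_
  · exact I.TS_sum_le_coef hC₈ hC₉ h9 hη hη6 ha _ hXe hX₀e hX₀X c2 c3 c4 hT₀ hXT hTX hH1 hv 𝒯 h𝒯' hws hcard
  · rw [Finset.filter_congr (fun t _ => not_lt)]
    have hR : ∀ t ∈ 𝒯.filter (fun t => (Real.log X ^ 100)⁻¹ ≤ ‖(blockPrimePoly c (Real.exp (Real.log X ^ (97 / 100 : ℝ))) (Real.exp (Real.log X ^ (99 / 100 : ℝ)))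
          (Real.log X ^ (1 / 50 : ℝ)) v t)‖),
        ‖(blockPrimePoly c (Real.exp (Real.log X ^ (97 / 100 : ℝ))) (Real.exp (Real.log X ^ (99 / 100 : ℝ)))
          (Real.log X ^ (1 / 50 : ℝ)) v t) *
          blockCofactorPoly a X (Real.exp (Real.log X ^ (97 / 100 : ℝ)))
            (Real.exp (Real.log X ^ (99 / 100 : ℝ))) (Real.log X ^ (1 / 50 : ℝ)) v t‖ ^ 2 ≤
        (2 ^ I.J * (3 * C₃ * Real.log X ^ (1 / 50 - 1 / 16 : ℝ))) ^ 2 *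
          ‖(blockPrimePoly c (Real.exp (Real.log X ^ (97 / 100 : ℝ))) (Real.exp (Real.log X ^ (99 / 100 : ℝ)))
          (Real.log X ^ (1 / 50 : ℝ)) v t)‖ ^ 2 := by
      intro t ht
      have hb := hRv t (mem_filter.1 ht).1
      rw [norm_mul, mul_pow, mul_comm]
      exact mul_le_mul_of_nonneg_right (pow_le_pow_left₀ (norm_nonneg _) hb 2) (by positivity)
    refine (sum_le_sum hR).trans ?_
    rw [← mul_sum]
    refine mul_le_mul_of_nonneg_left ?_ (by positivity)
    exact MatomakiRadziwillU.TL_sum_sq_le hC₈ h8 hC₁₁ h11 hC hBT hc hXe c2 c3 c6 c7 hT₀ hXT hTX hv 𝒯 h𝒯' hws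

set_option maxHeartbeats 400000 in
/-- **All blocks** (§8.3): with `PV` the bound of `sum_block_le`,
`∑_{v ∈ ℐ} ∫_𝒰 |Q_{v,H} R_{v,H}|² dt ≤ #ℐ · 2 PV` (discretisation into `𝒯₀ ∪ 𝒯₁`, then `sum_block_le` for each).
[cite: MatomakiRadziwillAnnals2016, §8.3] -/
theorem sum_blocks_integral_le_coef {C₃ C₈ C₉ C₁₁ C : ℝ} (hC₈ : 0 ≤ C₈)
    (h8 : (∀ (P T V : ℝ) (a : ℕ → ℂ) (𝒯 : Finset ℝ), 2 ≤ P → P ^ 2 ≤ T →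
      Real.exp (Real.exp 4) ≤ T → 1 ≤ V → (∀ p, ‖a p‖ ≤ 1) → (∀ t ∈ 𝒯, |t| ≤ T) →
      (∀ t ∈ 𝒯, ∀ t' ∈ 𝒯, t ≠ t' → 1 ≤ |t - t'|) →
      (∀ t ∈ 𝒯, V⁻¹ ≤ ‖∑ p ∈ (Finset.Icc ⌈P⌉₊ ⌊2 * P⌋₊).filter Nat.Prime,
          a p * (p : ℂ) ^ (-(1 + (t : ℂ) * Complex.I))‖) →
      ((Finset.card 𝒯 : ℕ) : ℝ) ≤ C₈ * V ^ 2 * T ^ (2 * Real.log V / Real.log P)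
        * Real.exp (4 * (Real.log T / Real.log P) * Real.log (Real.log T)))) (hC₉ : 0 ≤ C₉) (h9 : (∀ (N : ℕ) (a : ℕ → ℂ) (T : ℝ) (𝒯 : Finset ℝ), 1 ≤ N → 1 ≤ T →
      (∀ t ∈ 𝒯, |t| ≤ T) → (∀ t ∈ 𝒯, ∀ t' ∈ 𝒯, t ≠ t' → 1 ≤ |t - t'|) →
      ∑ t ∈ 𝒯, ‖∑ n ∈ Finset.Icc 1 N, a n * (n : ℂ) ^ (-((t : ℂ) * Complex.I))‖ ^ 2 ≤
        C₉ * (N + (Finset.card 𝒯 : ℕ) * Real.sqrt T) * Real.log (2 * T) * ∑ n ∈ Finset.Icc 1 N, ‖a n‖ ^ 2)) (hC₁₁ : 0 ≤ C₁₁) (h11 : (∀ (P T : ℝ) (a : ℕ → ℂ) (𝒯 : Finset ℝ), 2 ≤ P → 2 ≤ T →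
      (∀ t ∈ 𝒯, |t| ≤ T) → (∀ t ∈ 𝒯, ∀ t' ∈ 𝒯, t ≠ t' → 1 ≤ |t - t'|) →
      ∑ t ∈ 𝒯, ‖∑ p ∈ (Finset.Icc ⌈P⌉₊ ⌊2 * P⌋₊).filter Nat.Prime,
          a p * (p : ℂ) ^ (-((t : ℂ) * Complex.I))‖ ^ 2 ≤
        C₁₁ * (P + ((Finset.card 𝒯 : ℕ) : ℝ) * P * Real.exp (-(Real.log P / Real.log T ^ (2 / 3 + 1 / 10 : ℝ)))
            * Real.log T ^ 2)
          * ∑ p ∈ (Finset.Icc ⌈P⌉₊ ⌊2 * P⌋₊).filter Nat.Prime, ‖a p‖ ^ 2 / Real.log P))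
    (hC : 0 ≤ C) (hBT : ∀ N M : ℕ, 2 ≤ M → (#((Ioc N (N + M)).filter Nat.Prime) : ℝ) ≤ C * M / Real.log M)
    (hη : 0 < η) (hη6 : η < 1 / 6) (a c : ℕ → ℂ) (ha : ∀ m, ‖a m‖ ≤ 1) (hc : ∀ p, ‖c p‖ ≤ 1) {X : ℝ}
    (hXe : Real.exp 1 ≤ X) (hX₀ : Real.exp 2 ≤ X₀) (hX₀X : X₀ ≤ X) (hLX₀ : Real.log X ≤ 2 * Real.log X₀)
    (c2 : 2 ≤ Real.log X ^ (1 / 50 : ℝ)) (c3 : 40 * Real.log X ^ (99 / 100 : ℝ) ≤ Real.log X)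
    (c4 : Real.log X ^ (1 / 14 : ℝ) * Real.sqrt (Real.log X) *
      Real.exp (2 / 3 * Real.sqrt (Real.log X) + Real.log X ^ (99 / 100 : ℝ) - 2 * η * Real.log X) ≤ 1)
    (c6 : Real.log X ^ 202 * Real.exp (408 * Real.log X ^ (3 / 100 : ℝ) * Real.log (Real.log X)
      - Real.log X ^ (61 / 300 : ℝ) / 2) ≤ 1)
    (c7 : 4 * Real.log X ≤ Real.exp (Real.log X ^ (97 / 100 : ℝ) / 2))
    {T₀ T Tᵢ : ℝ} (hT₀ : 0 ≤ T₀) (hXT : X ^ (1 / 4 : ℝ) ≤ T) (hTX : T ≤ X) (hTᵢ : Tᵢ ≤ T) (hH1 : 2 ≤ I.Hpar 1)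
    (hR : ∀ v ∈ (Icc ⌊Real.log X ^ (1 / 50 : ℝ) * Real.log (Real.exp (Real.log X ^ (97 / 100 : ℝ)))⌋₊
      ⌊Real.log X ^ (1 / 50 : ℝ) * Real.log (Real.exp (Real.log X ^ (99 / 100 : ℝ)))⌋₊), ∀ t ∈ Set.Icc T₀ Tᵢ,
      ‖blockCofactorPoly a X (Real.exp (Real.log X ^ (97 / 100 : ℝ))) (Real.exp (Real.log X ^ (99 / 100 : ℝ))) (Real.log X ^ (1 / 50 : ℝ)) v t‖ ≤
        2 ^ I.J * (3 * C₃ * Real.log X ^ (1 / 50 - 1 / 16 : ℝ))) :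
    ∑ v ∈ (Icc ⌊Real.log X ^ (1 / 50 : ℝ) * Real.log (Real.exp (Real.log X ^ (97 / 100 : ℝ)))⌋₊
      ⌊Real.log X ^ (1 / 50 : ℝ) * Real.log (Real.exp (Real.log X ^ (99 / 100 : ℝ)))⌋₊), ∫ t in I.Uset c T₀ Tᵢ,
        ‖(blockPrimePoly c (Real.exp (Real.log X ^ (97 / 100 : ℝ))) (Real.exp (Real.log X ^ (99 / 100 : ℝ)))
          (Real.log X ^ (1 / 50 : ℝ)) v t) *
          blockCofactorPoly a X (Real.exp (Real.log X ^ (97 / 100 : ℝ)))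
            (Real.exp (Real.log X ^ (99 / 100 : ℝ))) (Real.log X ^ (1 / 50 : ℝ)) v t‖ ^ 2 ≤
      #((Icc ⌊Real.log X ^ (1 / 50 : ℝ) * Real.log (Real.exp (Real.log X ^ (97 / 100 : ℝ)))⌋₊
      ⌊Real.log X ^ (1 / 50 : ℝ) * Real.log (Real.exp (Real.log X ^ (99 / 100 : ℝ)))⌋₊)) * (2 * (2 * C₉ * (4 + 4 ^ 20 * C₈) * Real.log X * ((Real.log X ^ 100) ^ 2)⁻¹ +
        (2 ^ I.J * (3 * C₃ * Real.log X ^ (1 / 50 - 1 / 16 : ℝ))) ^ 2 *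
          (24 * C₁₁ * C * (1 + C₈) / (Real.log X ^ (1 / 50 : ℝ) * (Real.log X ^ (97 / 100 : ℝ)) ^ 2)))) := by
  classical
  rw [← nsmul_eq_mul, ← sum_const]
  refine sum_le_sum fun v hv => ?_
  -- discretise
  set g : ℝ → ℝ := fun t => ‖(blockPrimePoly c (Real.exp (Real.log X ^ (97 / 100 : ℝ))) (Real.exp (Real.log X ^ (99 / 100 : ℝ)))
          (Real.log X ^ (1 / 50 : ℝ)) v t) *
      blockCofactorPoly a X (Real.exp (Real.log X ^ (97 / 100 : ℝ)))
        (Real.exp (Real.log X ^ (99 / 100 : ℝ))) (Real.log X ^ (1 / 50 : ℝ)) v t‖ ^ 2 with hg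
  have hcQ : Continuous fun t : ℝ => (blockPrimePoly c (Real.exp (Real.log X ^ (97 / 100 : ℝ))) (Real.exp (Real.log X ^ (99 / 100 : ℝ)))
          (Real.log X ^ (1 / 50 : ℝ)) v t) := by
    unfold blockPrimePoly; exact MatomakiRadziwillLemma12.continuous_dsum _ _
  have hcR : Continuous fun t : ℝ => blockCofactorPoly a X (Real.exp (Real.log X ^ (97 / 100 : ℝ)))
      (Real.exp (Real.log X ^ (99 / 100 : ℝ))) (Real.log X ^ (1 / 50 : ℝ)) v t := by
    unfold blockCofactorPoly
    exact continuous_finsetSum _ fun m _ =>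
      (continuous_const.mul (MatomakiRadziwillLemma12.continuous_cpw m)).div_const _
  have hgc : Continuous g := ((hcQ.mul hcR).norm).pow 2
  have hg0 : ∀ t, 0 ≤ g t := fun t => by rw [hg]; positivity
  obtain ⟨𝒯, hprop, hws, hint⟩ := I.Uset_discretisation c hT₀ hgc hg0 (T := Tᵢ)
  refine hint.trans ?_
  rw [Fin.sum_univ_two, two_mul]
  have hprop' : ∀ i, ∀ t ∈ 𝒯 i, t ∈ Set.Icc T₀ T ∧ ∃ v ∈ I.blocks I.J,
      Real.exp (-(alpha η I.J * v / I.Hpar I.J)) ≤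
        ‖blockPrimePoly c (I.P I.J) (I.Q I.J) (I.Hpar I.J) v t‖ :=
    fun i t ht => ⟨⟨(hprop i t ht).1.1, (hprop i t ht).1.2.trans hTᵢ⟩,
      (hprop i t ht).2 I.J (mem_Icc.2 ⟨I.one_le_J, le_rfl⟩)⟩
  have hRpt : ∀ i, ∀ t ∈ 𝒯 i, ‖blockCofactorPoly a X (Real.exp (Real.log X ^ (97 / 100 : ℝ)))
        (Real.exp (Real.log X ^ (99 / 100 : ℝ))) (Real.log X ^ (1 / 50 : ℝ)) v t‖ ≤
      2 ^ I.J * (3 * C₃ * Real.log X ^ (1 / 50 - 1 / 16 : ℝ)) := fun i t ht => hR v hv t (hprop i t ht).1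
  refine add_le_add ?_ ?_ <;>
    exact I.sum_block_le_coef hC₈ h8 hC₉ h9 hC₁₁ h11 hC hBT hη hη6 a c ha hc hXe hX₀ hX₀X hLX₀ c2 c3 c4 c6 c7
      hT₀ hXT hTX hH1 hv _ (hRpt _) (hprop' _) (hws _)


/-! ### The bound for `∫_𝒰`, general coefficients -/

set_option maxHeartbeats 400000 in
/-- **§8.3: the bound for `∫_𝒰 |F(1+it)|² dt`** ("Combining the above estimates, we get the bound
`∫_𝒰 |F(1+it)|² dt ≪ H (log X)² (log X)^{-1/8+o(1)} (log Q)²/(log P)⁴ + (T/X + 1)(1/H + log P/log Q)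
≪ (T/X + 1)(log X)^{-1/48+o(1)}`"), in the explicit form: for `0 < η < 1/6`, `f` multiplicative with `|f| ≤ 1`,
`X` satisfying the size conditions `c2`–`c7` on `L = log X`, `X^{1/4} ≤ T ≤ X` and `H₁ ≥ 2`,
`∫_𝒰 |F(1+it)|² dt ≤ (T/X + 1) · 20000 (2 + K(2e⁶+1)) L^{-1/50} + 160000 C₉ (4 + 4^20 C₈) L^{-1/50}
  + 17280000 C₃² C₁₁ C (1+C₈) 4^J L^{-1/40}`,
where `𝒰 ⊂ [(log X)^{1/15}, T]`, the parameters are `H = L^{1/50}`, `P = exp(L^{97/100})`, `Q = exp(L^{99/100})`,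
and `C₃, C₈, C₉, C₁₁, C, K` are the constants of Lemmas 3, 8, 9, 11, Brun–Titchmarsh and the sieve bound
`card_Icc_filter_forall_not_dvd_le` (the factor `4^J`, "`2^J ≪ (log X)^{o(1)}`", is removed in the final
assembly). [cite: MatomakiRadziwillAnnals2016, §8.3] -/
theorem integral_Uset_bound_coef {C₃ C₈ C₉ C₁₁ C K : ℝ} (hC₈ : 0 ≤ C₈)
    (h8 : (∀ (P T V : ℝ) (a : ℕ → ℂ) (𝒯 : Finset ℝ), 2 ≤ P → P ^ 2 ≤ T →
      Real.exp (Real.exp 4) ≤ T → 1 ≤ V → (∀ p, ‖a p‖ ≤ 1) → (∀ t ∈ 𝒯, |t| ≤ T) →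
      (∀ t ∈ 𝒯, ∀ t' ∈ 𝒯, t ≠ t' → 1 ≤ |t - t'|) →
      (∀ t ∈ 𝒯, V⁻¹ ≤ ‖∑ p ∈ (Finset.Icc ⌈P⌉₊ ⌊2 * P⌋₊).filter Nat.Prime,
          a p * (p : ℂ) ^ (-(1 + (t : ℂ) * Complex.I))‖) →
      ((Finset.card 𝒯 : ℕ) : ℝ) ≤ C₈ * V ^ 2 * T ^ (2 * Real.log V / Real.log P)
        * Real.exp (4 * (Real.log T / Real.log P) * Real.log (Real.log T)))) (hC₉ : 0 ≤ C₉) (h9 : (∀ (N : ℕ) (a : ℕ → ℂ) (T : ℝ) (𝒯 : Finset ℝ), 1 ≤ N → 1 ≤ T →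
      (∀ t ∈ 𝒯, |t| ≤ T) → (∀ t ∈ 𝒯, ∀ t' ∈ 𝒯, t ≠ t' → 1 ≤ |t - t'|) →
      ∑ t ∈ 𝒯, ‖∑ n ∈ Finset.Icc 1 N, a n * (n : ℂ) ^ (-((t : ℂ) * Complex.I))‖ ^ 2 ≤
        C₉ * (N + (Finset.card 𝒯 : ℕ) * Real.sqrt T) * Real.log (2 * T) * ∑ n ∈ Finset.Icc 1 N, ‖a n‖ ^ 2)) (hC₁₁ : 0 ≤ C₁₁) (h11 : (∀ (P T : ℝ) (a : ℕ → ℂ) (𝒯 : Finset ℝ), 2 ≤ P → 2 ≤ T →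
      (∀ t ∈ 𝒯, |t| ≤ T) → (∀ t ∈ 𝒯, ∀ t' ∈ 𝒯, t ≠ t' → 1 ≤ |t - t'|) →
      ∑ t ∈ 𝒯, ‖∑ p ∈ (Finset.Icc ⌈P⌉₊ ⌊2 * P⌋₊).filter Nat.Prime,
          a p * (p : ℂ) ^ (-((t : ℂ) * Complex.I))‖ ^ 2 ≤
        C₁₁ * (P + ((Finset.card 𝒯 : ℕ) : ℝ) * P * Real.exp (-(Real.log P / Real.log T ^ (2 / 3 + 1 / 10 : ℝ)))
            * Real.log T ^ 2)
          * ∑ p ∈ (Finset.Icc ⌈P⌉₊ ⌊2 * P⌋₊).filter Nat.Prime, ‖a p‖ ^ 2 / Real.log P))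
    (hC : 0 ≤ C) (hBT : ∀ N M : ℕ, 2 ≤ M → (#((Ioc N (N + M)).filter Nat.Prime) : ℝ) ≤ C * M / Real.log M)
    (hK0 : 0 ≤ K) (hK : ∀ X P' Q' : ℝ, 1 ≤ X → 2 ≤ P' → P' ≤ Q' →
      (#((Icc ⌈X⌉₊ ⌊2 * X⌋₊).filter
          (fun n : ℕ => ∀ p ∈ (Icc ⌈P'⌉₊ ⌊Q'⌋₊).filter Nat.Prime, ¬ p ∣ n)) : ℝ) ≤
        K * ((X + 1) * (Real.exp (6 / Real.log P') * (Real.log P' / Real.log Q')) + (Q' + 1) ^ (10 : ℕ)))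
    (hη : 0 < η) (hη6 : η < 1 / 6) (a c : ℕ → ℂ) (ha : ∀ m, ‖a m‖ ≤ 1) (hc : ∀ p, ‖c p‖ ≤ 1) {X : ℝ}
    (hXe : Real.exp 1 ≤ X) (hX₀ : Real.exp 2 ≤ X₀) (hX₀X : X₀ ≤ X) (hLX₀ : Real.log X ≤ 2 * Real.log X₀)
    (c2 : 2 ≤ Real.log X ^ (1 / 50 : ℝ)) (c3 : 40 * Real.log X ^ (99 / 100 : ℝ) ≤ Real.log X)
    (c4 : Real.log X ^ (1 / 14 : ℝ) * Real.sqrt (Real.log X) *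
      Real.exp (2 / 3 * Real.sqrt (Real.log X) + Real.log X ^ (99 / 100 : ℝ) - 2 * η * Real.log X) ≤ 1)
    (c5 : Real.log X * Real.exp (-(Real.log X ^ (1 / 100 : ℝ) / 6)) ≤ Real.log X ^ (1 / 50 - 1 / 16 : ℝ))
    (c6 : Real.log X ^ 202 * Real.exp (408 * Real.log X ^ (3 / 100 : ℝ) * Real.log (Real.log X)
      - Real.log X ^ (61 / 300 : ℝ) / 2) ≤ 1)
    (c7 : 4 * Real.log X ≤ Real.exp (Real.log X ^ (97 / 100 : ℝ) / 2))
    {T₀ T Tᵢ : ℝ} (hT₀ : 0 ≤ T₀) (hXT : X ^ (1 / 4 : ℝ) ≤ T) (hTX : T ≤ X) (hTᵢ : Tᵢ ≤ T) (hH1 : 2 ≤ I.Hpar 1)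
    (hfac : ∀ m p : ℕ, p.Prime → Real.exp (Real.log X ^ (97 / 100 : ℝ)) ≤ p →
      (p : ℝ) ≤ Real.exp (Real.log X ^ (99 / 100 : ℝ)) → ¬ p ∣ m → a (m * p) = a m * c p)
    (hR : ∀ v ∈ (Icc ⌊Real.log X ^ (1 / 50 : ℝ) * Real.log (Real.exp (Real.log X ^ (97 / 100 : ℝ)))⌋₊
      ⌊Real.log X ^ (1 / 50 : ℝ) * Real.log (Real.exp (Real.log X ^ (99 / 100 : ℝ)))⌋₊), ∀ t ∈ Set.Icc T₀ Tᵢ,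
      ‖blockCofactorPoly a X (Real.exp (Real.log X ^ (97 / 100 : ℝ))) (Real.exp (Real.log X ^ (99 / 100 : ℝ))) (Real.log X ^ (1 / 50 : ℝ)) v t‖ ≤
        2 ^ I.J * (3 * C₃ * Real.log X ^ (1 / 50 - 1 / 16 : ℝ))) :
    ∫ t in I.Uset c T₀ Tᵢ,
        ‖∑ n ∈ Icc ⌈X⌉₊ ⌊2 * X⌋₊, a n * (n : ℂ) ^ (-(1 + (t : ℂ) * Complex.I))‖ ^ 2 ≤
      (T / X + 1) * (20000 * (2 + K * (2 * Real.exp 6 + 1))) * Real.log X ^ (-(1 / 50) : ℝ) +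
        160000 * C₉ * (4 + 4 ^ 20 * C₈) * Real.log X ^ (-(1 / 50) : ℝ) +
        17280000 * C₃ ^ 2 * C₁₁ * C * (1 + C₈) * 4 ^ I.J * Real.log X ^ (-(1 / 40) : ℝ) := by
  classical
  have hX0 : 0 < X := (Real.exp_pos 1).trans_le hXe
  have hL1 : 1 ≤ Real.log X := by rw [← Real.log_exp 1]; exact Real.log_le_log (Real.exp_pos 1) hXe
  have hL0 : 0 < Real.log X := by linarith
  obtain ⟨hL400, h40, hL99, hL97, h97, h9799⟩ := MatomakiRadziwillU.Lfacts hL1 c2 c3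
  have hX1 : 1 ≤ X := by have := Real.add_one_le_exp (1 : ℝ); linarith
  have hXexp : X = Real.exp (Real.log X) := (Real.exp_log hX0).symm
  have hXrpow : X ^ (1 / 4 : ℝ) = Real.exp (Real.log X * (1 / 4)) := Real.rpow_def_of_pos hX0 _
  have hT1 : 1 ≤ T := by
    rw [hXrpow] at hXT
    have := Real.add_one_le_exp (Real.log X * (1 / 4)); nlinarith
  -- the parameters
  have hH1' : 1 ≤ Real.log X ^ (1 / 50 : ℝ) := by linarith
  have hP1 : 1 ≤ Real.exp (Real.log X ^ (97 / 100 : ℝ)) := Real.one_le_exp (by positivity)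
  have hP2 : 2 ≤ Real.exp (Real.log X ^ (97 / 100 : ℝ)) := by
    have := Real.add_one_le_exp (Real.log X ^ (97 / 100 : ℝ)); linarith
  have hPQ : Real.exp (Real.log X ^ (97 / 100 : ℝ)) ≤ Real.exp (Real.log X ^ (99 / 100 : ℝ)) :=
    Real.exp_le_exp.2 h9799
  -- Lemma 12 on `𝒰 ⊆ [T₀, Tᵢ] ⊆ [-T, T]`
  have h12 : ∫ t in I.Uset c T₀ Tᵢ,
        ‖∑ n ∈ Icc ⌈X⌉₊ ⌊2 * X⌋₊, a n * (n : ℂ) ^ (-(1 + (t : ℂ) * Complex.I))‖ ^ 2 ≤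
      20000 * ((Real.log X ^ (1 / 50 : ℝ) * Real.log (Real.exp (Real.log X ^ (99 / 100 : ℝ)) /
          Real.exp (Real.log X ^ (97 / 100 : ℝ)))) *
          (∑ v ∈ Icc ⌊Real.log X ^ (1 / 50 : ℝ) * Real.log (Real.exp (Real.log X ^ (97 / 100 : ℝ)))⌋₊
              ⌊Real.log X ^ (1 / 50 : ℝ) * Real.log (Real.exp (Real.log X ^ (99 / 100 : ℝ)))⌋₊,
            ∫ t in I.Uset c T₀ Tᵢ,
              ‖blockPrimePoly c (Real.exp (Real.log X ^ (97 / 100 : ℝ))) (Real.exp (Real.log X ^ (99 / 100 : ℝ)))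
                  (Real.log X ^ (1 / 50 : ℝ)) v t *
                blockCofactorPoly a X (Real.exp (Real.log X ^ (97 / 100 : ℝ)))
                  (Real.exp (Real.log X ^ (99 / 100 : ℝ))) (Real.log X ^ (1 / 50 : ℝ)) v t‖ ^ 2)
        + (T + X) / X * (1 / Real.log X ^ (1 / 50 : ℝ) + 1 / Real.exp (Real.log X ^ (97 / 100 : ℝ))
            + ∑ n ∈ (Icc ⌈X⌉₊ ⌊2 * X⌋₊).filter
                (fun n : ℕ => ∀ p ∈ (Icc ⌈Real.exp (Real.log X ^ (97 / 100 : ℝ))⌉₊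
                  ⌊Real.exp (Real.log X ^ (99 / 100 : ℝ))⌋₊).filter Nat.Prime, ¬ p ∣ n),
                ‖a n‖ ^ 2 / n)) := by
    have hsub : I.Uset c T₀ Tᵢ ⊆ Set.Icc (-T) T :=
      (I.Uset_subset _ T₀ Tᵢ).trans (Set.Icc_subset_Icc (by linarith) hTᵢ)
    exact MatomakiRadziwillLemma12.lemma12_bound X T _ _ _ a a c (I.Uset c T₀ Tᵢ) hX1 hT1 hP1 hPQ hH1'
      ha ha hc hfac hsub
  refine h12.trans ?_
  -- the main term
  have hblocks := I.sum_blocks_integral_le_coef hC₈ h8 hC₉ h9 hC₁₁ h11 hC hBT hη hη6 a c ha hc hXe hX₀ hX₀X hLX₀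
    c2 c3 c4 c6 c7 hT₀ hXT hTX hTᵢ hH1 hR
  have hA0 : 0 ≤ Real.log X ^ (1 / 50 : ℝ) *
      Real.log (Real.exp (Real.log X ^ (99 / 100 : ℝ)) / Real.exp (Real.log X ^ (97 / 100 : ℝ))) := by
    refine mul_nonneg (by linarith) (Real.log_nonneg ?_)
    rwa [one_le_div (Real.exp_pos _)]
  have hA : Real.log X ^ (1 / 50 : ℝ) *
      Real.log (Real.exp (Real.log X ^ (99 / 100 : ℝ)) / Real.exp (Real.log X ^ (97 / 100 : ℝ))) ≤
      Real.log X ^ (101 / 100 : ℝ) := by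
    rw [Real.log_div (Real.exp_pos _).ne' (Real.exp_pos _).ne', Real.log_exp, Real.log_exp,
      show (101 / 100 : ℝ) = 1 / 50 + 99 / 100 by norm_num, Real.rpow_add hL0]
    refine mul_le_mul_of_nonneg_left ?_ (by linarith)
    linarith [Real.rpow_nonneg hL0.le (97 / 100 : ℝ)]
  have hNU := MatomakiRadziwillLemma12.card_blocks_le (H := Real.log X ^ (1 / 50 : ℝ)) (by linarith) hP1 hPQ
  have hL2 : 2 ≤ Real.log X ^ (101 / 100 : ℝ) :=
    c2.trans (Real.rpow_le_rpow_of_exponent_le hL1 (by norm_num))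
  have hmain := MatomakiRadziwillU.main_numeric (J := I.J) hL1 hL2 hC₈ hC₉ hC₁₁ hC hA0 hA hNU hblocks
  -- the remainder
  obtain ⟨hrem1, hrem2⟩ := MatomakiRadziwillU.remainder_numeric hXexp hL1 c2 c3 c5
  have hS := (coprime_sum_le_card_div_coef ha hX0 (Real.exp (Real.log X ^ (97 / 100 : ℝ)))
    (Real.exp (Real.log X ^ (99 / 100 : ℝ)))).trans
    (mul_le_mul_of_nonneg_right (hK X _ _ hX1 hP2 hPQ) (by positivity))
  rw [mul_assoc K] at hS
  have hS' := hS.trans (mul_le_mul_of_nonneg_left hrem2 hK0)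
  have hTX0 : 0 ≤ (T + X) / X := by positivity
  have hrem : (T + X) / X * (1 / Real.log X ^ (1 / 50 : ℝ) + 1 / Real.exp (Real.log X ^ (97 / 100 : ℝ)) +
      ∑ n ∈ (Icc ⌈X⌉₊ ⌊2 * X⌋₊).filter (fun n : ℕ => ∀ p ∈ (Icc ⌈Real.exp (Real.log X ^ (97 / 100 : ℝ))⌉₊
        ⌊Real.exp (Real.log X ^ (99 / 100 : ℝ))⌋₊).filter Nat.Prime, ¬ p ∣ n), ‖a n‖ ^ 2 / n) ≤
      (T / X + 1) * ((2 + K * (2 * Real.exp 6 + 1)) * Real.log X ^ (-(1 / 50) : ℝ)) := by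
    have : (T + X) / X = T / X + 1 := by field_simp
    rw [← this]
    refine mul_le_mul_of_nonneg_left ?_ hTX0
    linarith only [hrem1, hS']
  -- combine
  linarith only [hmain, hrem]


end SieveIntervalSystem

end Literature.NumberTheory.Sieve
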